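import Summits.AtomisticToContinuum.BoseEinsteinCondensation.Theorems.BECConjugateDominationPositiveMinimiserSmallTime
import Summits.AtomisticToContinuum.BoseEinsteinCondensation.Theorems.BECConjugateDominationPositiveMinimiserFreeHeatDeriv
import HarnessLib

/-!
# The Feynman–Kac generator under one free smoothing, for BOUNDED MEASURABLE interactions, I:
# the pointwise split (stub `stub_smoothedGenerator` = S6r-B1 of line `third-law-current-floor`,
# crux `HardCoreExtension`, stmt-AtomisticToContinuum-11786)

For a measurable pair potential `v` with bounded periodisation `v^per ≤ C` the real interaction
`W = (∑_{i<j} v^per(xᵢ - xⱼ)).toReal` is bounded and measurable but possibly DIScontinuous. This file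
(theorems only, no definition): bounds for `W`; the real action `A_h(Y, ω) = ∫₀ʰ W(B_r) dr` as a real
integral with clipped displacement times; `P_hΨ₀(Y) − e^{-hH}Ψ₀(Y) = E[(1 − e^{-A_h})Ψ₀(Y + √2b_h)]`;
and the split of the error functional `E_h(Y) = P_hΨ₀(Y) − e^{-hH}Ψ₀(Y) − hW(Y)Ψ₀(Y)` into a piece
bounded UNIFORMLY in `Y` by `M(N²Ch)² + N²Ch(η + (2M/δ)E‖√2b_h‖)` (`|1 − e^{-a} − a| ≤ a²`, uniform
continuity of `Ψ₀`) plus the third piece `F₃(Y) = (E[A_h(Y,·)] − hW(Y))Ψ₀(Y)`, which is NOT small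
pointwise for discontinuous `W` and is treated under the smoothing in part II. [folklore]
-/

noncomputable section

namespace Summit.AtomisticToContinuum.BoseEinsteinCondensation.Cruxes.HardCoreExtension.ThirdLawCurrentFloor

open MeasureTheory ProbabilityTheory Filter Set Metric
open scoped ENNReal NNReal Topology
open Literature.MathematicalPhysics.QuantumManyBody.BoseGas
open Literature.Probability.Process (brownian runSup runSup_nonneg)
open Summit.AtomisticToContinuum.BoseEinsteinCondensation.Theorems.PositiveMinimiser

namespace SmoothedGenerator

variable {N : ℕ} {v : ℝ → ℝ≥0∞} {L : ℝ} {C : ℝ≥0}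

/-! ### The real interaction `W` -/

/-- `W` is measurable. [folklore] -/
theorem measurable_Wr (hv : Measurable v) (L : ℝ) : Measurable ((fun Y : Config N => (periodicInteraction v L Y).toReal)) :=
  (measurable_periodicInteraction hv L).ennreal_toReal

/-- `0 ≤ W`. [folklore] -/
theorem Wr_nonneg (v : ℝ → ℝ≥0∞) (L : ℝ) (Y : Config N) : 0 ≤ (periodicInteraction v L Y).toReal := ENNReal.toReal_nonneg

/-- `|W| ≤ N² C`. [folklore] -/
theorem abs_Wr_le (hC : ∀ x, periodizedPotential v L x ≤ C) (Y : Config N) :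
    |(periodicInteraction v L Y).toReal| ≤ ((N * N : ℕ) : ℝ) * C := by
  rw [abs_of_nonneg (Wr_nonneg v L Y)]; exact toReal_periodicInteraction_le hC Y

/-- `v^per ∘ pairs = ofReal W` (the interaction is finite). [folklore] -/
theorem periodicInteraction_eq_ofReal_Wr (hC : ∀ x, periodizedPotential v L x ≤ C) (Y : Config N) :
    periodicInteraction v L Y = ENNReal.ofReal ((periodicInteraction v L Y).toReal) := by
  rw [ENNReal.ofReal_toReal (periodicInteraction_ne_top hC Y)]

/-! ### The action along a path as a real integral -/

/-- The clipped displacement time `min(r⁺, t)`: equal to `r⁺` for `r ≤ t`. [folklore] -/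
theorem min_toNNReal_eq {r : ℝ} {t : ℝ≥0} (hr : r ≤ t) : min r.toNNReal t = r.toNNReal :=
  min_eq_left (Real.toNNReal_le_iff_le_coe.2 hr)

/-- `r ↦ W(Y + √2 b_{min(r⁺,t)})` is measurable along every path. [folklore] -/
theorem measurable_Wr_path (hv : Measurable v) (L : ℝ) (Y : Config N) (ω : PathSpace N) (t : ℝ≥0) :
    Measurable fun r : ℝ => (periodicInteraction v L (Y + displacement (min r.toNNReal t) ω)).toReal :=
  (measurable_Wr hv L).comp (measurable_const.add
    ((continuous_displacement ω).measurable.comp (measurable_real_toNNReal.min measurable_const)))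

/-- **The action as a real integral with clipped times**: for `0 ≤ h`, `t = h⁺`,
`(∫₀ʰ V^per(B_r) dr).toReal = ∫_{r ∈ (0,h]} W(Y + √2 b_{min(r⁺,t)}) dr`. [folklore] -/
theorem toReal_periodicPathAction_eq_integral (hv : Measurable v) (hC : ∀ x, periodizedPotential v L x ≤ C)
    {h : ℝ} (hh : 0 ≤ h) (Y : Config N) (ω : PathSpace N) :
    (periodicPathAction v L h Y ω).toReal =
      ∫ r in Ioc (0 : ℝ) h, (periodicInteraction v L (Y + displacement (min r.toNNReal h.toNNReal) ω)).toReal := by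
  have hmeas := measurable_Wr_path hv L Y ω h.toNNReal
  have hnn : 0 ≤ᵐ[volume.restrict (Ioc (0 : ℝ) h)]
      fun r : ℝ => (periodicInteraction v L (Y + displacement (min r.toNNReal h.toNNReal) ω)).toReal :=
    Eventually.of_forall fun r => Wr_nonneg v L _
  rw [integral_eq_lintegral_of_nonneg_ae hnn hmeas.aestronglyMeasurable]
  congr 1
  unfold periodicPathAction
  refine setLIntegral_congr_fun measurableSet_Ioc fun r hr => ?_
  rw [periodicInteraction_eq_ofReal_Wr hC, worldLine_eq_add_displacement,
    min_toNNReal_eq (le_of_le_of_eq hr.2 (Real.coe_toNNReal h hh).symm)]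

/-- **The action minus `h W(Y)` as a real integral of differences**: for `0 ≤ h`,
`(∫₀ʰ V^per(B_r) dr).toReal - h W(Y) = ∫_{r ∈ (0,h]} (W(Y + √2 b_{min(r⁺,h⁺)}) - W(Y)) dr`. [folklore] -/
theorem toReal_periodicPathAction_sub_eq_integral (hv : Measurable v)
    (hC : ∀ x, periodizedPotential v L x ≤ C) {h : ℝ} (hh : 0 ≤ h) (Y : Config N) (ω : PathSpace N) :
    (periodicPathAction v L h Y ω).toReal - h * (periodicInteraction v L Y).toReal =
      ∫ r in Ioc (0 : ℝ) h, ((periodicInteraction v L (Y + displacement (min r.toNNReal h.toNNReal) ω)).toReal - (periodicInteraction v L Y).toReal) := by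
  have hmeas := measurable_Wr_path hv L Y ω h.toNNReal
  have hint : Integrable (fun r : ℝ => (periodicInteraction v L (Y + displacement (min r.toNNReal h.toNNReal) ω)).toReal)
      (volume.restrict (Ioc (0 : ℝ) h)) := by
    refine Integrable.mono' (integrable_const (((N * N : ℕ) : ℝ) * C)) hmeas.aestronglyMeasurable
      (Eventually.of_forall fun r => ?_)
    rw [Real.norm_eq_abs]; exact abs_Wr_le hC _
  rw [integral_sub hint (integrable_const _), toReal_periodicPathAction_eq_integral hv hC hh,
    setIntegral_const, Real.volume_real_Ioc_of_le hh, sub_zero, smul_eq_mul]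

/-! ### `P_hΨ₀ − e^{-hH}Ψ₀` as one expectation, and the pointwise split -/

section Pointwise

variable {Ψ₀ : Config N → ℝ} {M : ℝ}

/-- The displaced observable `ω ↦ Ψ₀(Y + √2 b_t)` is integrable for bounded measurable `Ψ₀`. [folklore] -/
theorem integrable_comp_add_displacement' (hΨm : Measurable Ψ₀) (hM : ∀ Y, |Ψ₀ Y| ≤ M) (Y : Config N)
    (t : ℝ≥0) : Integrable (fun ω : PathSpace N => Ψ₀ (Y + displacement t ω)) (wienerPaths N) :=
  Integrable.of_bound (hΨm.comp (measurable_const.add (measurable_displacement t))).aestronglyMeasurable M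
    (Eventually.of_forall fun ω => by rw [Real.norm_eq_abs]; exact hM _)

/-- The real action `A_h(Y, ω) = (∫₀ʰ V^per(B_r) dr).toReal` lies in `[0, N²C h]` (`h ≥ 0`). [folklore] -/
theorem toReal_periodicPathAction_mem (hC : ∀ x, periodizedPotential v L x ≤ C) {h : ℝ} (hh : 0 ≤ h)
    (Y : Config N) (ω : PathSpace N) :
    0 ≤ (periodicPathAction v L h Y ω).toReal ∧
      (periodicPathAction v L h Y ω).toReal ≤ ((N * N : ℕ) : ℝ) * C * h := by
  refine ⟨ENNReal.toReal_nonneg, ?_⟩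
  have hA : periodicPathAction v L h Y ω ≤ (N * N : ℕ) * (C : ℝ≥0∞) * ENNReal.ofReal h :=
    periodicPathAction_le_of_bound (C := (C : ℝ≥0∞)) (fun x => hC x) h Y ω
  have := ENNReal.toReal_mono (ENNReal.mul_ne_top (ENNReal.mul_ne_top (ENNReal.natCast_ne_top _)
    ENNReal.coe_ne_top) ENNReal.ofReal_ne_top) hA
  rw [ENNReal.toReal_mul, ENNReal.toReal_mul, ENNReal.toReal_ofReal hh] at this
  simpa using this

/-- The weighted displaced observable `ω ↦ e^{-A_h} Ψ₀(Y + √2 b_{h⁺})` is integrable. [folklore] -/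
theorem integrable_exp_mul_comp (hv : Measurable v) (hΨm : Measurable Ψ₀) (hM : ∀ Y, |Ψ₀ Y| ≤ M)
    (h : ℝ) (Y : Config N) :
    Integrable (fun ω : PathSpace N => Real.exp (-(periodicPathAction v L h Y ω).toReal) *
      Ψ₀ (Y + displacement h.toNNReal ω)) (wienerPaths N) := by
  refine Integrable.of_bound ?_ M (Eventually.of_forall fun ω => ?_)
  · exact ((measurable_periodicPathAction hv L h Y).ennreal_toReal.neg.exp.mul
      (hΨm.comp (measurable_const.add (measurable_displacement _)))).aestronglyMeasurable
  · rw [norm_mul, Real.norm_eq_abs, Real.norm_eq_abs, abs_of_pos (Real.exp_pos _)]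
    calc Real.exp (-(periodicPathAction v L h Y ω).toReal) * |Ψ₀ (Y + displacement h.toNNReal ω)|
        ≤ 1 * M := mul_le_mul (Real.exp_le_one_iff.2 (neg_nonpos.2 ENNReal.toReal_nonneg)) (hM _)
          (abs_nonneg _) zero_le_one
      _ = M := one_mul M

/-- **`P_hΨ₀(Y) − e^{-hH}Ψ₀(Y) = E[(1 − e^{-A_h}) Ψ₀(Y + √2 b_{h⁺})]`** (bounded measurable `Ψ₀`,
`v^per ≤ C`). [folklore] -/
theorem heatOpR_sub_pfkReal_eq (hv : Measurable v) (hC : ∀ x, periodizedPotential v L x ≤ C)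
    (hΨm : Measurable Ψ₀) (hM : ∀ Y, |Ψ₀ Y| ≤ M) (h : ℝ) (Y : Config N) :
    heatOpR h Ψ₀ Y - pfkReal v L h Ψ₀ Y =
      ∫ ω, (1 - Real.exp (-(periodicPathAction v L h Y ω).toReal)) *
        Ψ₀ (Y + displacement h.toNNReal ω) ∂wienerPaths N := by
  have e1 : heatOpR h Ψ₀ Y = ∫ ω, Ψ₀ (Y + displacement h.toNNReal ω) ∂wienerPaths N := rfl
  have e2 : pfkReal v L h Ψ₀ Y = ∫ ω, Real.exp (-(periodicPathAction v L h Y ω).toReal) *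
      Ψ₀ (Y + displacement h.toNNReal ω) ∂wienerPaths N := by
    unfold pfkReal
    refine integral_congr_ae (Eventually.of_forall fun ω => ?_)
    simp only
    rw [toReal_periodicFKWeight_eq_exp hC, worldLine_eq_add_displacement]
  rw [e1, e2, ← integral_sub (integrable_comp_add_displacement' hΨm hM Y _)
    (integrable_exp_mul_comp hv hΨm hM h Y)]
  refine integral_congr_ae (Eventually.of_forall fun ω => ?_)
  simp only
  ring

/-- **Pointwise bound of the first two pieces of the split.** With `a = A_h ∈ [0, N²Ch]`, `N²Ch ≤ 1`,
`B = Y + √2 b_{h⁺}`: `|(1 − e^{-a})Ψ₀(B) − hWΨ₀(Y) − (a − hW(Y))Ψ₀(Y)| ≤ M(N²Ch)² + N²Ch·|Ψ₀(B) − Ψ₀(Y)|`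
(`|1 − e^{-a} − a| ≤ a²`). [folklore] -/
theorem abs_split_le (hC : ∀ x, periodizedPotential v L x ≤ C) (hM : ∀ Y, |Ψ₀ Y| ≤ M) {h : ℝ}
    (hh : 0 ≤ h) (hsmall : ((N * N : ℕ) : ℝ) * C * h ≤ 1) (Y : Config N) (ω : PathSpace N) :
    |(1 - Real.exp (-(periodicPathAction v L h Y ω).toReal)) * Ψ₀ (Y + displacement h.toNNReal ω) -
        h * (periodicInteraction v L Y).toReal * Ψ₀ Y - ((periodicPathAction v L h Y ω).toReal - h * (periodicInteraction v L Y).toReal) * Ψ₀ Y| ≤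
      M * (((N * N : ℕ) : ℝ) * C * h) ^ 2 +
        ((N * N : ℕ) : ℝ) * C * h * |Ψ₀ (Y + displacement h.toNNReal ω) - Ψ₀ Y| := by
  have hM0 : 0 ≤ M := (abs_nonneg _).trans (hM 0)
  set CVh : ℝ := ((N * N : ℕ) : ℝ) * C * h with hCVh
  set a : ℝ := (periodicPathAction v L h Y ω).toReal with ha
  set B : Config N := Y + displacement h.toNNReal ω with hB
  obtain ⟨ha0, haCV⟩ := toReal_periodicPathAction_mem hC hh Y ω
  rw [← ha] at ha0 haCV
  have ha1 : a ≤ 1 := haCV.trans hsmall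
  have hsplit : (1 - Real.exp (-a)) * Ψ₀ B - h * (periodicInteraction v L Y).toReal * Ψ₀ Y - (a - h * (periodicInteraction v L Y).toReal) * Ψ₀ Y =
      -(Real.exp (-a) - 1 + a) * Ψ₀ B + a * (Ψ₀ B - Ψ₀ Y) := by ring
  rw [hsplit]
  have hexp : |Real.exp (-a) - 1 + a| ≤ a ^ 2 := by
    have h := Real.abs_exp_sub_one_sub_id_le (x := -a) (by rw [abs_neg, abs_of_nonneg ha0]; exact ha1)
    rw [neg_sq] at h
    simpa [sub_neg_eq_add] using h
  have e1 : |-(Real.exp (-a) - 1 + a) * Ψ₀ B| ≤ M * CVh ^ 2 := by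
    rw [abs_mul, abs_neg]
    calc |Real.exp (-a) - 1 + a| * |Ψ₀ B| ≤ a ^ 2 * M :=
          mul_le_mul hexp (hM B) (abs_nonneg _) (sq_nonneg _)
      _ ≤ CVh ^ 2 * M := mul_le_mul_of_nonneg_right (pow_le_pow_left₀ ha0 haCV 2) hM0
      _ = M * CVh ^ 2 := by ring
  have e2 : |a * (Ψ₀ B - Ψ₀ Y)| ≤ CVh * |Ψ₀ B - Ψ₀ Y| := by
    rw [abs_mul, abs_of_nonneg ha0]
    exact mul_le_mul_of_nonneg_right haCV (abs_nonneg _)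
  exact (abs_add_le _ _).trans (add_le_add e1 e2)

/-- **Uniform continuity against the first moment of the displacement**: if `‖k‖ < δ ⇒
|Ψ₀(Y + k) − Ψ₀(Y)| ≤ η` and `|Ψ₀| ≤ M`, then `E|Ψ₀(Y + √2 b_t) − Ψ₀(Y)| ≤ η + (2M/δ)·(√2·3N·2√t)`.
[folklore] -/
theorem integral_abs_sub_le (hM : ∀ Y, |Ψ₀ Y| ≤ M) {η δ : ℝ} (hη : 0 ≤ η)
    (hδ : 0 < δ) (hUC : ∀ Y k : Config N, ‖k‖ < δ → |Ψ₀ (Y + k) - Ψ₀ Y| ≤ η) (Y : Config N) (t : ℝ≥0) :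
    ∫ ω, |Ψ₀ (Y + displacement t ω) - Ψ₀ Y| ∂wienerPaths N ≤
      η + 2 * M / δ * (Real.sqrt 2 * ((3 * N : ℕ) * (2 * Real.sqrt t))) := by
  have hM0 : 0 ≤ M := (abs_nonneg _).trans (hM 0)
  have hpt : ∀ ω : PathSpace N, |Ψ₀ (Y + displacement t ω) - Ψ₀ Y| ≤ η + 2 * M / δ * ‖displacement t ω‖ := by
    intro ω
    by_cases hk : ‖displacement t ω‖ < δ
    · exact (hUC Y _ hk).trans (le_add_of_nonneg_right (by positivity))
    · have hk : δ ≤ ‖displacement t ω‖ := not_lt.1 hk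
      have h1 : |Ψ₀ (Y + displacement t ω) - Ψ₀ Y| ≤ 2 * M :=
        (abs_sub _ _).trans (by linarith [hM (Y + displacement t ω), hM Y])
      have h2 : 2 * M ≤ 2 * M / δ * ‖displacement t ω‖ := by
        rw [div_mul_eq_mul_div, le_div_iff₀ hδ]
        exact mul_le_mul_of_nonneg_left hk (by positivity)
      linarith
  calc ∫ ω, |Ψ₀ (Y + displacement t ω) - Ψ₀ Y| ∂wienerPaths N
      ≤ ∫ ω, (η + 2 * M / δ * ‖displacement t ω‖) ∂wienerPaths N := by
        refine integral_mono_of_nonneg (Eventually.of_forall fun ω => abs_nonneg _)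
          ((integrable_const η).add ((integrable_norm_displacement t).const_mul _))
          (Eventually.of_forall hpt)
    _ = η + 2 * M / δ * ∫ ω, ‖displacement t ω‖ ∂wienerPaths N := by
        rw [integral_add (integrable_const η) ((integrable_norm_displacement t).const_mul _),
          integral_const, integral_const_mul]
        simp
    _ ≤ η + 2 * M / δ * (Real.sqrt 2 * ((3 * N : ℕ) * (2 * Real.sqrt t))) := by
        refine add_le_add le_rfl (mul_le_mul_of_nonneg_left (integral_norm_displacement_le le_rfl) ?_)
        positivity

/-- The real action is integrable in the sample (bounded by `N²Ch`). [folklore] -/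
theorem integrable_toReal_periodicPathAction (hv : Measurable v) (hC : ∀ x, periodizedPotential v L x ≤ C)
    {h : ℝ} (hh : 0 ≤ h) (Y : Config N) :
    Integrable (fun ω : PathSpace N => (periodicPathAction v L h Y ω).toReal) (wienerPaths N) :=
  Integrable.of_bound (measurable_periodicPathAction hv L h Y).ennreal_toReal.aestronglyMeasurable
    (((N * N : ℕ) : ℝ) * C * h) (Eventually.of_forall fun ω => by
      obtain ⟨h0, h1⟩ := toReal_periodicPathAction_mem hC hh Y ω
      rw [Real.norm_eq_abs, abs_of_nonneg h0]; exact h1)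

/-- **Uniform bound of the first two pieces**: for `0 ≤ h` with `N²Ch ≤ 1` and every `Y`,
`|E_h(Y) − F₃(Y)| ≤ M(N²Ch)² + N²Ch·(η + (2M/δ)(√2·3N·2√h⁺))`. [folklore] -/
theorem abs_errPiece_sub_thirdPiece_le (hv : Measurable v) (hC : ∀ x, periodizedPotential v L x ≤ C)
    (hΨm : Measurable Ψ₀) (hM : ∀ Y, |Ψ₀ Y| ≤ M) {η δ : ℝ} (hη : 0 ≤ η) (hδ : 0 < δ)
    (hUC : ∀ Y k : Config N, ‖k‖ < δ → |Ψ₀ (Y + k) - Ψ₀ Y| ≤ η) {h : ℝ} (hh : 0 ≤ h)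
    (hsmall : ((N * N : ℕ) : ℝ) * C * h ≤ 1) (Y : Config N) :
    |(heatOpR h Ψ₀ Y - pfkReal v L h Ψ₀ Y - h * (periodicInteraction v L Y).toReal * Ψ₀ Y) - (((∫ ω, (periodicPathAction v L h Y ω).toReal ∂wienerPaths N) - h * (periodicInteraction v L Y).toReal) * Ψ₀ Y)| ≤
      M * (((N * N : ℕ) : ℝ) * C * h) ^ 2 + ((N * N : ℕ) : ℝ) * C * h *
        (η + 2 * M / δ * (Real.sqrt 2 * ((3 * N : ℕ) * (2 * Real.sqrt h.toNNReal)))) := by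
  have hM0 : 0 ≤ M := (abs_nonneg _).trans (hM 0)
  set CVh : ℝ := ((N * N : ℕ) : ℝ) * C * h with hCVh
  have hCVh0 : 0 ≤ CVh := by positivity
  -- both pieces as expectations
  have hi1 : Integrable (fun ω : PathSpace N => (1 - Real.exp (-(periodicPathAction v L h Y ω).toReal)) *
      Ψ₀ (Y + displacement h.toNNReal ω)) (wienerPaths N) := by
    have := (integrable_comp_add_displacement' hΨm hM Y h.toNNReal).sub
      (integrable_exp_mul_comp (L := L) hv hΨm hM h Y)
    refine this.congr (Eventually.of_forall fun ω => ?_)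
    simp only [Pi.sub_apply]; ring
  have hi3 : Integrable (fun ω : PathSpace N =>
      ((periodicPathAction v L h Y ω).toReal - h * (periodicInteraction v L Y).toReal) * Ψ₀ Y) (wienerPaths N) :=
    ((integrable_toReal_periodicPathAction hv hC hh Y).sub (integrable_const _)).mul_const _
  have hE : (heatOpR h Ψ₀ Y - pfkReal v L h Ψ₀ Y - h * (periodicInteraction v L Y).toReal * Ψ₀ Y) = ∫ ω, ((1 - Real.exp (-(periodicPathAction v L h Y ω).toReal)) *
      Ψ₀ (Y + displacement h.toNNReal ω) - h * (periodicInteraction v L Y).toReal * Ψ₀ Y) ∂wienerPaths N := by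
    rw [integral_sub hi1 (integrable_const _), integral_const, ← heatOpR_sub_pfkReal_eq hv hC hΨm hM h Y]
    simp
  have hF : (((∫ ω, (periodicPathAction v L h Y ω).toReal ∂wienerPaths N) - h * (periodicInteraction v L Y).toReal) * Ψ₀ Y) = ∫ ω, ((periodicPathAction v L h Y ω).toReal - h * (periodicInteraction v L Y).toReal) * Ψ₀ Y
      ∂wienerPaths N := by
    rw [integral_mul_const, integral_sub (integrable_toReal_periodicPathAction hv hC hh Y) (integrable_const _),
      integral_const]
    simp
  have hi13 : Integrable (fun ω : PathSpace N => (1 - Real.exp (-(periodicPathAction v L h Y ω).toReal)) *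
      Ψ₀ (Y + displacement h.toNNReal ω) - h * (periodicInteraction v L Y).toReal * Ψ₀ Y) (wienerPaths N) := hi1.sub (integrable_const _)
  rw [hE, hF, ← integral_sub hi13 hi3]
  have hi4 : Integrable (fun ω : PathSpace N => CVh * |Ψ₀ (Y + displacement h.toNNReal ω) - Ψ₀ Y|)
      (wienerPaths N) :=
    ((((integrable_comp_add_displacement' hΨm hM Y h.toNNReal).sub (integrable_const (Ψ₀ Y))).abs).const_mul
      CVh).congr (Eventually.of_forall fun ω => rfl)
  -- integrate the pointwise bound
  calc |∫ ω, ((1 - Real.exp (-(periodicPathAction v L h Y ω).toReal)) * Ψ₀ (Y + displacement h.toNNReal ω) -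
            h * (periodicInteraction v L Y).toReal * Ψ₀ Y - ((periodicPathAction v L h Y ω).toReal - h * (periodicInteraction v L Y).toReal) * Ψ₀ Y) ∂wienerPaths N|
      ≤ ∫ ω, (M * CVh ^ 2 + CVh * |Ψ₀ (Y + displacement h.toNNReal ω) - Ψ₀ Y|) ∂wienerPaths N := by
        rw [← Real.norm_eq_abs]
        refine (norm_integral_le_integral_norm _).trans ?_
        refine integral_mono_of_nonneg (Eventually.of_forall fun ω => norm_nonneg _)
          ((integrable_const _).add hi4) (Eventually.of_forall fun ω => ?_)
        simp only [Real.norm_eq_abs]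
        exact abs_split_le hC hM hh hsmall Y ω
    _ = M * CVh ^ 2 + CVh * ∫ ω, |Ψ₀ (Y + displacement h.toNNReal ω) - Ψ₀ Y| ∂wienerPaths N := by
        rw [integral_add (integrable_const _) hi4, integral_const, integral_const_mul]
        simp
    _ ≤ M * CVh ^ 2 + CVh * (η + 2 * M / δ * (Real.sqrt 2 * ((3 * N : ℕ) * (2 * Real.sqrt h.toNNReal)))) :=
        add_le_add le_rfl (mul_le_mul_of_nonneg_left (integral_abs_sub_le hM hη hδ hUC Y _) hCVh0)

end Pointwise

end SmoothedGenerator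

open SmoothedGenerator in
/-- **Registered sub-goal `stub_smoothedGeneratorPointwise` of stub S6r-B1** (line `third-law-current-floor`,
crux `HardCoreExtension`): the uniform-in-`Y` bound of the first two pieces of the split of the error functional
`E_h(Y) = P_hΨ₀(Y) − e^{-hH}Ψ₀(Y) − hW(Y)Ψ₀(Y)` minus the third piece `F₃(Y) = (E[A_h(Y,·)] − hW(Y))Ψ₀(Y)`:
`|E_h(Y) − F₃(Y)| ≤ M(N²Ch)² + N²Ch·(η + (2M/δ)(√2·3N·2√h⁺))` for bounded measurable `Ψ₀` with modulus of
continuity `(η, δ)`, `0 ≤ h`, `N²Ch ≤ 1` (= `abs_errPiece_sub_thirdPiece_le`, closed form). [folklore] -/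
theorem stub_smoothedGeneratorPointwise :
    ∀ {N : ℕ} (L : ℝ) (v : ℝ → ℝ≥0∞) (C : ℝ≥0), Measurable v → (∀ x, periodizedPotential v L x ≤ C) →
      ∀ (Ψ₀ : Config N → ℝ) (M : ℝ), Measurable Ψ₀ → (∀ Y, |Ψ₀ Y| ≤ M) →
      ∀ (η δ : ℝ), 0 ≤ η → 0 < δ → (∀ Y k : Config N, ‖k‖ < δ → |Ψ₀ (Y + k) - Ψ₀ Y| ≤ η) →
      ∀ h : ℝ, 0 ≤ h → ((N * N : ℕ) : ℝ) * C * h ≤ 1 → ∀ Y : Config N,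
        |(heatOpR h Ψ₀ Y - pfkReal v L h Ψ₀ Y - h * (periodicInteraction v L Y).toReal * Ψ₀ Y) -
            ((∫ ω, (periodicPathAction v L h Y ω).toReal ∂wienerPaths N) -
              h * (periodicInteraction v L Y).toReal) * Ψ₀ Y| ≤
          M * (((N * N : ℕ) : ℝ) * C * h) ^ 2 + ((N * N : ℕ) : ℝ) * C * h *
            (η + 2 * M / δ * (Real.sqrt 2 * ((3 * N : ℕ) * (2 * Real.sqrt h.toNNReal)))) :=
  fun _ _ _ hv hC _ _ hΨm hM _ _ hη hδ hUC _ hh hsmall Y =>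
    abs_errPiece_sub_thirdPiece_le hv hC hΨm hM hη hδ hUC hh hsmall Y

end Summit.AtomisticToContinuum.BoseEinsteinCondensation.Cruxes.HardCoreExtension.ThirdLawCurrentFloor

end
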